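import Mathlib.Combinatorics.HalesJewett
import Mathlib.Data.Finset.Sort
import Mathlib.Data.Finset.Max
import Literature.Combinatorics.HalesJewett.SubspaceToolkit
import Literature.Combinatorics.HalesJewett.GrahamRothschildPrefix
import HarnessLib

/-!
# Colourings of combinatorial lines, II: from prefix-determined to level-determined

Topic `Literature/Combinatorics/HalesJewett`. Second of three files (`GrahamRothschildPrefix`,
this file, `GrahamRothschildLines`) proving, from Mathlib's Hales–Jewett theorem, the consequence
of the Graham–Rothschild theorem used by P. Dodos, V. Kanellopoulos, K. Tyros, *A simple proof of
the density Hales–Jewett theorem*, IMRN 2014, as their Proposition 2 (every finite colouring of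
the combinatorial lines of a large cube is constant on the lines of an `m`-dimensional subspace).

* **Stage II** (`exists_subspace_levelDetermined`): over a finite *linearly ordered* index set
  `η`, a prefix-determined colouring of the lines of `η → α` (the colour of `l` depends only on the
  position `p` of its first variable coordinate and its letters before `p`,
  `PrefixDetermined`) becomes, on the lines of a suitable `M`-dimensional subspace `y`,
  *level-determined* (the colour of `y.line l` depends only on the position of the first variable
  of `l` in `Fin M`, `LevelDetermined`). Induction on `M`: cut `η` at its `(N+1)`-st element `i₀`;
  by the multidimensional Hales–Jewett theorem the colouring `x ↦ c(x ⌢ v ⌢ a₀ ⋯ a₀)` of the words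
  on `{e < i₀}` is constant on a large subspace `ρ`; relabel the variables of `ρ` by their first
  coordinates (so that the colouring induced on the lines of the parameter cube of `ρ` is again
  prefix-determined), apply the induction hypothesis inside, and add `i₀` as the new last
  variable; prefix-determinedness of `c` is used once more to ignore the letter at `i₀`.

## References
* P. Dodos, V. Kanellopoulos, K. Tyros, IMRN 2014 (12), 3340–3352, Proposition 2.
  [cite: DodosKanellopoulosTyros2014]
* R. L. Graham, B. L. Rothschild, *Ramsey's theorem for `n`-parameter sets*, Trans. AMS 159
  (1971), 257–292.
-/

namespace Literature.Combinatorics.HalesJewett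

open _root_.Combinatorics

namespace GrahamRothschild

variable {α κ : Type*}

/-!
### Stage II ingredients
-/

section bigLine

variable {η : Type*} [LinearOrder η] (i₀ : η) (a₀ : α)

/-- The line of `η → α` that is the word `w` below `i₀`, the variable at `i₀`, and the constant
letter `a₀` above `i₀`. [folklore] -/
def bigLine (w : {e // e < i₀} → Option α) : Line α η where
  idxFun e := if h : e < i₀ then w ⟨e, h⟩ else if e = i₀ then none else some a₀
  proper := ⟨i₀, by simp⟩

/-- Coordinates of `bigLine` below `i₀`. [folklore] -/
theorem bigLine_apply_of_lt (w : {e // e < i₀} → Option α) {e : η} (h : e < i₀) :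
    (bigLine i₀ a₀ w).idxFun e = w ⟨e, h⟩ := by
  simp [bigLine, h]

/-- The coordinate `i₀` of `bigLine` is the variable. [folklore] -/
theorem bigLine_apply_self (w : {e // e < i₀} → Option α) :
    (bigLine i₀ a₀ w).idxFun i₀ = none := by
  simp [bigLine]

/-- Coordinates of `bigLine` above `i₀`. [folklore] -/
theorem bigLine_apply_of_gt (w : {e // e < i₀} → Option α) {e : η} (h : i₀ < e) :
    (bigLine i₀ a₀ w).idxFun e = some a₀ := by
  simp [bigLine, not_lt.2 h.le, h.ne']

end bigLine

section relabel

variable {θ I : Type*} [LinearOrder I] [Fintype I] [DecidableEq α] [DecidableEq θ]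

/-- The first coordinate at which the variable `j` of the subspace `ρ` occurs. [folklore] -/
def firstCoord (ρ : Subspace θ α I) (j : θ) : I :=
  (Finset.univ.filter fun i => ρ.idxFun i = Sum.inr j).min'
    (by obtain ⟨i, hi⟩ := ρ.proper j; exact ⟨i, by simp [hi]⟩)

/-- The variable `j` does occur at `firstCoord ρ j`. [folklore] -/
theorem idxFun_firstCoord (ρ : Subspace θ α I) (j : θ) :
    ρ.idxFun (firstCoord ρ j) = Sum.inr j := by
  unfold firstCoord
  exact (Finset.mem_filter.1 (Finset.min'_mem
    (Finset.univ.filter fun i => ρ.idxFun i = Sum.inr j) _)).2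

/-- `firstCoord ρ j` is the least coordinate carrying the variable `j`. [folklore] -/
theorem firstCoord_le (ρ : Subspace θ α I) {j : θ} {i : I} (h : ρ.idxFun i = Sum.inr j) :
    firstCoord ρ j ≤ i :=
  Finset.min'_le _ _ (by simp [h])

/-- Distinct variables have distinct first coordinates. [folklore] -/
theorem firstCoord_injective (ρ : Subspace θ α I) : Function.Injective (firstCoord ρ) := by
  intro j j' h
  have h1 := idxFun_firstCoord ρ j
  rw [h, idxFun_firstCoord ρ j'] at h1
  exact Sum.inr_injective h1.symm

variable [Fintype θ]

/-- The set of first coordinates of the variables of `ρ`. [folklore] -/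
def firstCoords (ρ : Subspace θ α I) : Finset I :=
  Finset.univ.map ⟨firstCoord ρ, firstCoord_injective ρ⟩

/-- `firstCoord ρ j` as an element of `firstCoords ρ`. [folklore] -/
def firstCoord' (ρ : Subspace θ α I) (j : θ) : firstCoords ρ :=
  ⟨firstCoord ρ j, Finset.mem_map_of_mem _ (Finset.mem_univ j)⟩

/-- There are as many first coordinates as variables. [folklore] -/
theorem card_firstCoords (ρ : Subspace θ α I) :
    Fintype.card (firstCoords ρ) = Fintype.card θ := by
  rw [Fintype.card_coe, firstCoords, Finset.card_map, Finset.card_univ]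

/-- **Relabelling the variables of a subspace by their first coordinates**: the same subspace,
with variable set `firstCoords ρ ⊆ I` ordered as a subset of `I`. [folklore] -/
def relabel (ρ : Subspace θ α I) : Subspace (firstCoords ρ) α I where
  idxFun i := (ρ.idxFun i).map id (firstCoord' ρ)
  proper s := by
    obtain ⟨j, -, hj⟩ := Finset.mem_map.1 s.2
    refine ⟨firstCoord ρ j, ?_⟩
    simp only [idxFun_firstCoord, Sum.map_inr, Sum.inr.injEq]
    exact Subtype.ext hj

/-- A coordinate carrying the (relabelled) variable `s` lies at or after `s`. [folklore] -/
theorem le_of_relabel_idxFun {ρ : Subspace θ α I} {i : I} {s : firstCoords ρ}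
    (h : (relabel ρ).idxFun i = Sum.inr s) : (s : I) ≤ i := by
  simp only [relabel] at h
  rcases hρ : ρ.idxFun i with a | j
  · simp [hρ] at h
  · simp only [hρ, Sum.map_inr, Sum.inr.injEq] at h
    rw [← h]
    exact firstCoord_le ρ hρ

/-- The relabelled variable `s` occurs at the coordinate `s` itself. [folklore] -/
theorem relabel_idxFun_self (ρ : Subspace θ α I) (s : firstCoords ρ) :
    (relabel ρ).idxFun (s : I) = Sum.inr s := by
  obtain ⟨j, -, hj⟩ := Finset.mem_map.1 s.2
  have hs : (s : I) = firstCoord ρ j := hj.symm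
  simp only [relabel, hs, idxFun_firstCoord, Sum.map_inr, Sum.inr.injEq]
  exact Subtype.ext hj

/-- The points of the relabelled subspace are points of `ρ`. [folklore] -/
theorem relabel_apply (ρ : Subspace θ α I) (x : firstCoords ρ → α) :
    relabel ρ x = ρ (x ∘ firstCoord' ρ) := by
  funext i
  simp only [Subspace.coe_apply, relabel]
  cases ρ.idxFun i <;> simp

end relabel

section step

variable {η : Type*} [LinearOrder η] {i₀ : η} {a₀ : α} {m : ℕ}
variable (W : Subspace (Fin m) α {e // e < i₀})

/-- The `(m+1)`-variable word of Stage II: the subspace `W` of the words below `i₀` (variables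
`Fin m`, embedded by `Fin.castSucc`), the new last variable at `i₀`, the constant `a₀` above.
[folklore] -/
def snocSubspace (i₀ : η) (a₀ : α) (W : Subspace (Fin m) α {e // e < i₀}) :
    Subspace (Fin (m + 1)) α η where
  idxFun e := if h : e < i₀ then (W.idxFun ⟨e, h⟩).map id Fin.castSucc
    else if e = i₀ then Sum.inr (Fin.last m) else Sum.inl a₀
  proper j := by
    induction j using Fin.lastCases with
    | last => exact ⟨i₀, by simp⟩
    | cast j =>
      obtain ⟨i, hi⟩ := W.proper j
      exact ⟨i, by simp [i.2, hi]⟩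

/-- Below `i₀`, the variable word of a line of `snocSubspace` is `W` acting on the initial part
of the line. [folklore] -/
theorem snocSubspace_pat_of_lt (w : Fin (m + 1) → Option α) {e : η} (h : e < i₀) :
    (snocSubspace i₀ a₀ W).pat w e = W.pat (w ∘ Fin.castSucc) ⟨e, h⟩ := by
  simp only [Subspace.pat, snocSubspace, h, dif_pos]
  cases W.idxFun ⟨e, h⟩ <;> simp

/-- At `i₀`, a line of `snocSubspace` carries the last entry of its parameter word. [folklore] -/
theorem snocSubspace_pat_self (w : Fin (m + 1) → Option α) :
    (snocSubspace i₀ a₀ W).pat w i₀ = w (Fin.last m) := by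
  simp [Subspace.pat, snocSubspace]

/-- Above `i₀`, a line of `snocSubspace` is the constant `a₀`. [folklore] -/
theorem snocSubspace_pat_of_gt (w : Fin (m + 1) → Option α) {e : η} (h : i₀ < e) :
    (snocSubspace i₀ a₀ W).pat w e = some a₀ := by
  simp [Subspace.pat, snocSubspace, not_lt.2 h.le, h.ne']

/-- The initial part of a line of `Fin (m+1) → α` whose first variable is not the last
coordinate. [folklore] -/
def initLine (l : Line α (Fin (m + 1))) (p : Fin m) (hp : l.idxFun p.castSucc = none) :
    Line α (Fin m) :=
  ⟨l.idxFun ∘ Fin.castSucc, p, hp⟩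

end step

end GrahamRothschild

open GrahamRothschild in
/-- **Stage II.** For every `M` and all large finite linearly ordered index sets `η`: a
prefix-determined colouring of the lines of `η → α` is level-determined on the lines of some
`M`-dimensional subspace (module docstring for the proof).
[cite: DodosKanellopoulosTyros2014, Proposition 2 (proof, second stage)] -/
theorem exists_subspace_levelDetermined (α : Type) [Fintype α] [Nonempty α] [DecidableEq α]
    (κ : Type) [Fintype κ] (M : ℕ) :
    ∃ L : ℕ, ∀ (η : Type) [Fintype η] [LinearOrder η], L ≤ Fintype.card η →
      ∀ c : Line α η → κ, PrefixDetermined c →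
        ∃ y : Subspace (Fin M) α η, LevelDetermined fun l => c (y.line l) := by
  obtain ⟨a₀⟩ := ‹Nonempty α›
  induction M with
  | zero =>
    refine ⟨0, fun η _ _ _ c _ => ⟨⟨fun _ => Sum.inl a₀, fun e => e.elim0⟩, fun l => ?_⟩⟩
    exact l.proper.choose.elim0
  | succ M ih =>
    obtain ⟨L', hL'⟩ := ih
    obtain ⟨N, hN⟩ := exists_mono_subspace_of_card_le α κ (Fin L')
    refine ⟨N + 1, fun η _ _ hη c hc => ?_⟩
    -- cut `η` at its `(N+1)`-st element `i₀`
    set f : Fin (Fintype.card η) ↪o η := Finset.univ.orderEmbOfFin Finset.card_univ with hf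
    set i₀ : η := f ⟨N, hη⟩ with hi₀
    have hI : N ≤ Fintype.card {e // e < i₀} := by
      let g : Fin N → {e // e < i₀} := fun j =>
        ⟨f ⟨j, lt_of_lt_of_le j.2 (Nat.le_of_succ_le hη)⟩, f.strictMono (Fin.mk_lt_mk.2 j.2)⟩
      have hg : Function.Injective g := fun j j' h => by
        have := congr_arg Subtype.val h
        exact Fin.ext (Fin.mk.inj_iff.1 (f.injective this))
      simpa using Fintype.card_le_of_injective g hg
    -- multidimensional Hales–Jewett below `i₀`
    obtain ⟨ρ, k₀, hk₀⟩ := hN {e // e < i₀} hI fun x => c (bigLine i₀ a₀ (some ∘ x))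
    -- the induced colouring of the lines of the relabelled parameter cube is prefix-determined
    set ρ' := relabel ρ with hρ'
    set c'' : Line α (firstCoords ρ) → κ := fun l' => c (bigLine i₀ a₀ (ρ'.pat l'.idxFun))
      with hc''
    have hc''pd : PrefixDetermined c'' := by
      intro l₁ l₂ s h₁ h₂ hlt
      apply hc _ _ (s : {e // e < i₀}).1
      · rw [bigLine_apply_of_lt _ _ _ (s : {e // e < i₀}).2, Subtype.coe_eta,
          Subspace.pat_apply_inr (relabel_idxFun_self ρ s), h₁]
      · rw [bigLine_apply_of_lt _ _ _ (s : {e // e < i₀}).2, Subtype.coe_eta,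
          Subspace.pat_apply_inr (relabel_idxFun_self ρ s), h₂]
      · intro e he
        have hei : e < i₀ := he.trans (s : {e // e < i₀}).2
        rw [bigLine_apply_of_lt _ _ _ hei, bigLine_apply_of_lt _ _ _ hei]
        rcases hρe : ρ'.idxFun ⟨e, hei⟩ with a | t
        · rw [Subspace.pat_apply_inl hρe, Subspace.pat_apply_inl hρe]
          exact ⟨Option.some_ne_none a, rfl⟩
        · rw [Subspace.pat_apply_inr hρe, Subspace.pat_apply_inr hρe]
          have ht : t < s := by
            have h1 : ((t : {e // e < i₀}) : η) ≤ e := le_of_relabel_idxFun hρe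
            exact Subtype.coe_lt_coe.1 (Subtype.coe_lt_coe.1 (h1.trans_lt he))
          exact hlt t ht
    -- induction hypothesis inside
    obtain ⟨y', hy'⟩ := hL' (firstCoords ρ) (by rw [card_firstCoords]; simp) c'' hc''pd
    set W := ρ'.comp y' with hW
    refine ⟨snocSubspace i₀ a₀ W, fun l₁ l₂ p hp₁ hp₂ hlt => ?_⟩
    induction p using Fin.lastCases with
    | last =>
      -- all earlier coordinates honest: both lines are `bigLine` of points of `ρ`
      have key : ∀ l : Line α (Fin (M + 1)), l.idxFun (Fin.last M) = none →
          (∀ j : Fin M, l.idxFun j.castSucc ≠ none) →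
          c ((snocSubspace i₀ a₀ W).line l) = k₀ := by
        intro l hl hne
        set x : Fin M → α := fun j => (l.idxFun j.castSucc).get
          (Option.ne_none_iff_isSome.1 (hne j)) with hx
        have hlx : l.idxFun ∘ Fin.castSucc = some ∘ x := by
          funext j; simp [hx]
        have : (snocSubspace i₀ a₀ W).line l =
            bigLine i₀ a₀ (some ∘ ρ (y' x ∘ firstCoord' ρ)) := by
          refine Line.ext (funext fun e => ?_)
          rw [Subspace.line_idxFun]
          rcases lt_trichotomy e i₀ with he | rfl | he
          · rw [snocSubspace_pat_of_lt _ _ he, bigLine_apply_of_lt _ _ _ he, hlx,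
              Subspace.pat_some, hW, Subspace.comp_apply, relabel_apply]
          · rw [snocSubspace_pat_self, bigLine_apply_self, hl]
          · rw [snocSubspace_pat_of_gt _ _ he, bigLine_apply_of_gt _ _ _ he]
        rw [this]
        exact hk₀ _
      simp only
      rw [key l₁ hp₁ fun j => (hlt _ (Fin.castSucc_lt_last j)).1,
        key l₂ hp₂ fun j => (hlt _ (Fin.castSucc_lt_last j)).2]
    | cast p =>
      -- first variable inside: compare with the induced colouring through `i₀ ↦ none`
      have key : ∀ (l : Line α (Fin (M + 1))) (hl : l.idxFun p.castSucc = none),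
          c ((snocSubspace i₀ a₀ W).line l) = c'' (y'.line (initLine l p hl)) := by
        intro l hl
        -- the common variable word below `i₀`
        set v : {e // e < i₀} → Option α := ρ'.pat (y'.line (initLine l p hl)).idxFun with hv
        have hv' : ∀ (e : η) (he : e < i₀),
            (snocSubspace i₀ a₀ W).pat l.idxFun e = v ⟨e, he⟩ := fun e he => by
          rw [snocSubspace_pat_of_lt _ _ he, hv, hW, Subspace.line_idxFun, Subspace.comp_pat]
          rfl
        obtain ⟨q, hq, hqmin⟩ := exists_first_none v (by
          obtain ⟨i, hi⟩ := (W.line (initLine l p hl)).proper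
          rw [hW, Subspace.line_idxFun, Subspace.comp_pat] at hi
          exact ⟨i, hi⟩)
        apply hc _ _ (q : η)
        · rw [Subspace.line_idxFun, hv' _ q.2]; exact hq
        · rw [bigLine_apply_of_lt _ _ _ q.2]; exact hq
        · intro e he
          have hei : e < i₀ := he.trans q.2
          rw [Subspace.line_idxFun, hv' _ hei, bigLine_apply_of_lt _ _ _ hei]
          exact ⟨hqmin ⟨e, hei⟩ (Subtype.coe_lt_coe.1 he), rfl⟩
      simp only
      rw [key l₁ hp₁, key l₂ hp₂]
      exact hy' _ _ p hp₁ hp₂ fun e he => hlt e.castSucc (Fin.castSucc_lt_castSucc_iff.2 he)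

end Literature.Combinatorics.HalesJewett
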